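import Mathlib
import Summits.Ventures.PercRepro.PuncturedLYMSplitCount

/-!
# PercRepro — (SP) BY POINT SPLITTING: THE REDUCTION TO THE DECORATED HALVES
(p10, gen 36)

With the counting theorem (PuncturedLYMSplitCount) the `x`-free half of the split of a uniform (SP)-instance at a point
`x` of nonnegative excess is again a UNIFORM instance — of the family `𝒞 ∖ x` on `S ∖ x` (the minor `M/x`) with row
mass `ρ − κ` — so it is covered by induction on the ground set.  THEOREM (`hasFlow_rowsOf_of_link`): if every
co-hyperplane family on fewer points has the flows of all its uniform instances, then a co-hyperplane family on `S` has
the flow of its uniform instance as soon as ONE point `x` of nonnegative excess has a flow of the `x`-HALF — the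
instance of `{C ∖ x}` on `S ∖ x` at level `j − 1` with row mass `ρ` and column demands `β − κ` on the columns whose
`x`-removal is a row (those received the cross edge) and `β` on the others.  So (PAV) reduces to the decorated halves.
-/

namespace PercRepro.PuncturedLYM.Split

open Finset

variable {α : Type} [DecidableEq α]

/-- The `x`-free rows of the family are the rows of the family `𝒞 ∖ x` on `S ∖ x`. -/
theorem rowsFree_rowsOf (S : Finset α) (j : ℕ) (𝒞 : Finset (Finset α)) (x : α) :
    rowsFree (rowsOf S j 𝒞) x = rowsOf (S.erase x) j (𝒞.filter (fun C => x ∉ C)) := by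
  ext X
  simp only [mem_rowsFree, mem_rowsOf, subset_erase, mem_filter]
  constructor
  · rintro ⟨⟨⟨hXS, hXc⟩, hC⟩, hxX⟩
    exact ⟨⟨⟨hXS, hxX⟩, hXc⟩, fun C hC' => hC C hC'.1⟩
  · rintro ⟨⟨⟨hXS, hxX⟩, hXc⟩, hC⟩
    refine ⟨⟨⟨hXS, hXc⟩, fun C hC' hCX => ?_⟩, hxX⟩
    exact hC C ⟨hC', fun h => hxX (hCX h)⟩ hCX

/-- The excess at `x` in the uniform instance equals `ρ·#P₀ − β·#Y₀`. -/
theorem excess_uniform_eq (S : Finset α) (j : ℕ) (𝒞 : Finset (Finset α)) (ρ β : ℚ)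
    (htot : ρ * (rowsOf S j 𝒞).card = β * (cols S j).card) (x : α) :
    excess S j (rowsOf S j 𝒞) (fun _ => ρ) (fun _ => β) x
      = ρ * (rowsFree (rowsOf S j 𝒞) x).card - β * (cols (S.erase x) j).card := by
  unfold excess
  rw [sum_const, sum_const, nsmul_eq_mul, nsmul_eq_mul]
  have hL := card_filter_add_card_filter_not (s := cols S j) (fun Y => x ∈ Y)
  have hL' : (cols S j).filter (fun Y => ¬ x ∈ Y) = cols (S.erase x) j := by
    ext Y; simp only [mem_filter, mem_cols, subset_erase]; tauto
  rw [hL'] at hL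
  have hP := card_filter_add_card_filter_not (s := rowsOf S j 𝒞) (fun X => x ∈ X)
  have hP' : (rowsOf S j 𝒞).filter (fun X => ¬ x ∈ X) = rowsFree (rowsOf S j 𝒞) x := rfl
  rw [hP'] at hP
  have e1 : (((cols S j).filter (fun Y => x ∈ Y)).card : ℚ) = (cols S j).card - (cols (S.erase x) j).card := by
    rw [← hL]; push_cast; ring
  have e2 : (((rowsOf S j 𝒞).filter (fun X => x ∈ X)).card : ℚ)
      = (rowsOf S j 𝒞).card - (rowsFree (rowsOf S j 𝒞) x).card := by
    rw [← hP]; push_cast; ring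
  rw [e1, e2]
  linear_combination -htot

/-- **THE REDUCTION.** Suppose every co-hyperplane family on fewer than `n` points has the flows of all its uniform
instances.  Let `𝒞` be a co-hyperplane family on `S` (`#S = n`, `0 < j`), `ρ, β ≥ 0` with `ρ·#P = β·#Y`, and let
`x ∈ S` be a point of nonnegative excess with `#P₀(x) > 0`, `κ = t(x)/#P₀(x)`.  If the `x`-half — the rows
`rowsLink (rowsOf S j 𝒞) x` on `S ∖ x` at level `j − 1`, row mass `ρ`, column demand `β − κ` on the columns that are
rows of `𝒞` and `β` on the others — has a flow, then so does the uniform instance of `𝒞`. -/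
theorem hasFlow_rowsOf_of_link (n : ℕ)
    (ih : ∀ (S' : Finset α) (j' : ℕ) (𝒞' : Finset (Finset α)) (ρ' β' : ℚ), S'.card < n → IsCoHypFamily S' j' 𝒞' →
      0 ≤ ρ' → 0 ≤ β' → ρ' * (rowsOf S' j' 𝒞').card = β' * (cols S' j').card →
      HasFlow S' j' (rowsOf S' j' 𝒞') (fun _ => ρ') (fun _ => β'))
    {S : Finset α} {j : ℕ} {𝒞 : Finset (Finset α)} (hn : S.card = n) (h : IsCoHypFamily S j 𝒞) (hj : 0 < j)
    {ρ β : ℚ} (hβ : 0 ≤ β) (htot : ρ * (rowsOf S j 𝒞).card = β * (cols S j).card)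
    {x : α} (hx : x ∈ S) (ht : 0 ≤ excess S j (rowsOf S j 𝒞) (fun _ => ρ) (fun _ => β) x)
    (hP0 : 0 < (rowsFree (rowsOf S j 𝒞) x).card)
    (h1 : HasFlow (S.erase x) (j - 1) (rowsLink (rowsOf S j 𝒞) x) (fun _ => ρ)
      (fun Y' => β - if Y' ∈ rowsOf S j 𝒞 then
        excess S j (rowsOf S j 𝒞) (fun _ => ρ) (fun _ => β) x / (rowsFree (rowsOf S j 𝒞) x).card else 0)) :
    HasFlow S j (rowsOf S j 𝒞) (fun _ => ρ) (fun _ => β) := by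
  set t := excess S j (rowsOf S j 𝒞) (fun _ => ρ) (fun _ => β) x with ht_def
  set κ := t / (rowsFree (rowsOf S j 𝒞) x).card with hκ_def
  have hP0q : (0 : ℚ) < (rowsFree (rowsOf S j 𝒞) x).card := by exact_mod_cast hP0
  obtain ⟨hκ0, hκβ⟩ := root_kappa_bounds h hj hβ htot hx ht hP0
  rw [← ht_def, ← hκ_def] at hκ0 hκβ
  have hPsub : rowsOf S j 𝒞 ⊆ S.powersetCard j := filter_subset _ _
  apply hasFlow_glue hPsub hj hx hκ0 _ h1
  -- the `x`-free half: the uniform instance of `𝒞 ∖ x` with row mass `ρ − κ`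
  rw [rowsFree_rowsOf]
  have hκa : κ * (rowsFree (rowsOf S j 𝒞) x).card = t := by rw [hκ_def]; field_simp
  have htot0 : (ρ - κ) * (rowsOf (S.erase x) j (𝒞.filter (fun C => x ∉ C))).card = β * (cols (S.erase x) j).card := by
    rw [← rowsFree_rowsOf, sub_mul, hκa, ht_def, excess_uniform_eq S j 𝒞 ρ β htot x]; ring
  have hρκ : 0 ≤ ρ - κ := by
    have h2 : 0 ≤ (ρ - κ) * (rowsOf (S.erase x) j (𝒞.filter (fun C => x ∉ C))).card := by
      rw [htot0]; exact mul_nonneg hβ (Nat.cast_nonneg _)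
    have hcard : (0 : ℚ) < (rowsOf (S.erase x) j (𝒞.filter (fun C => x ∉ C))).card := by
      rw [← rowsFree_rowsOf]; exact hP0q
    exact (mul_nonneg_iff_of_pos_right hcard).1 h2
  have hn' : (S.erase x).card < n := by
    have := card_pos.2 ⟨x, hx⟩
    rw [card_erase_of_mem hx]; omega
  exact ih (S.erase x) j (𝒞.filter (fun C => x ∉ C)) (ρ - κ) β hn' (isCoHypFamily_free h x) hρκ hβ htot0

end PercRepro.PuncturedLYM.Split
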